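import Literature.Geometry.Lorentzian.CauchyDevelopmentComap
import Literature.Geometry.Lorentzian.DataEmbeddingNormalSmooth
import Literature.Geometry.Lorentzian.AdiabaticTracking
import Literature.Geometry.Lorentzian.NullInfinity
import HarnessLib

/-!
# Re-indexing a vacuum Cauchy development along a diffeomorphism of the data manifold
# (same spacetime): maximality, complete null infinity and adiabatic tracking are invariant

If `𝒟 = (M, g, τ, ι, ν)` is a vacuum Cauchy development of the datum `D = (h, k)` on `X` and
`Φ : X → X` is a diffeomorphism (here: a homeomorphism which is smooth with injective
differentials, its inverse likewise), then `(M, g, τ, ι ∘ Φ, ν ∘ Φ)` is a vacuum Cauchy development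
of the pulled-back datum `Φ^* D = D.comap Φ` (`InitialDataSet.comap`, `InitialDataPullback.lean`):
the SAME spacetime, the data hypersurface `ι(X)` unchanged, only its parametrisation by `X`
re-indexed. This is the (trivial) diffeomorphism covariance of the Cauchy problem
(Choquet-Bruhat–Geroch, CMP 14 (1969), p. 330; Bartnik–Isenberg 2004, §2; Ringström 2009,
Def. 16.2–16.5): isometric data have "the same" developments.

* `InitialDataSet.comap_comap`, `comap_comp_eq_self` — functoriality of the pull-back of data
  (`(Φ^* D) ∘ Ψ^* = (Φ ∘ Ψ)^* D`, `= D` when `Φ ∘ Ψ = id`);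
* `VacuumCauchyDevelopment.precomp 𝒟 Φ` — the re-indexed development (fields from
  `DataEmbedding.comapAlong`; the Cauchy hypersurface is `range (ι ∘ Φ) = range ι`);
* `isMaximal_precomp_iff` — **`precomp 𝒟 Φ` is maximal iff `𝒟` is** (every development of `Φ^* D`
  re-indexes along `Φ⁻¹` to one of `(Φ^* D) ∘ (Φ⁻¹)^* = D`, and the universal property transports;
  the equality of data is used through `subst`, no casts appear in statements);
* `exists_isMaximal_comap_iff`, `forall_isMaximal_comap_iff` — MGHD existence, and any property of
  developments invariant under re-indexing, hold over all maximal developments of `Φ^* D` iff they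
  hold over all maximal developments of `D`;
* `LorentzianMetric.hasCompleteFutureNullInfinity_comp_homeomorph`,
  `hasCompleteFutureNullInfinity_precomp_iff`, `isAdiabaticallyTracked_precomp_iff` — complete
  future null infinity (sojourn form) and adiabatic tracking are invariant under re-indexing
  (compact sets of `X` correspond under `Φ`; `range (ι ∘ Φ) = range ι`);
* `censored_comap_iff`, `quietTracking_comap_iff`, `marginTracking_comap_iff` — the development-level
  clauses of the final state conjecture's layer-2 properties ("an MGHD exists and every MGHD has
  complete `𝓘⁺`", "every MGHD is adiabatically tracked at every accuracy", "… with one complexity")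
  are invariant under `D ↦ Φ^* D`.

Everything is proved; the only definition is `precomp`. Universe: `X : Type` (the summit's).

## References
* Y. Choquet-Bruhat, R. Geroch, Comm. Math. Phys. 14 (1969) 329–335, p. 330.
* H. Ringström, *The Cauchy Problem in General Relativity* (2009), Def. 16.2–16.5.
* R. Bartnik, J. Isenberg, *The constraint equations* (2004), §2.
-/

noncomputable section

open Bundle Set Function Filter Topology TopologicalSpace Manifold
open scoped Manifold ContDiff Topology

namespace Literature.Geometry.Lorentzian

/-! ### Complete future null infinity is invariant under re-indexing the data by a homeomorphism -/

namespace LorentzianMetric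

/-- **Complete future null infinity (sojourn form) is invariant under re-indexing the data
hypersurface by a homeomorphism**: for `Φ : Y ≃ₜ Y`, `(ι ∘ Φ, N ∘ Φ)` has complete `𝓘⁺` iff
`(ι, N)` does (the compact exceptional sets `B₀`, `B₁ ⊆ Y` are transported by `Φ`; the rays from
`p` for `(ι ∘ Φ, N ∘ Φ)` are the rays from `Φ p` for `(ι, N)`). Christodoulou, CQG 16 (1999),
pp. A26–A27 (the notion). [cite: Christodoulou1999, pp. A26–A27] -/
theorem hasCompleteFutureNullInfinity_comp_homeomorph {E : Type*} [NormedAddCommGroup E]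
    [NormedSpace ℝ E] {H : Type*} [TopologicalSpace H] {I : ModelWithCorners ℝ E H} {M : Type*}
    [TopologicalSpace M] [ChartedSpace H M] [IsManifold I ∞ M] {Y : Type*} [TopologicalSpace Y]
    (g : LorentzianMetric I ∞ M) [FiniteDimensional ℝ E] [CompleteSpace E] [g.HasLeviCivita]
    (τ : TimeOrientation g) (ι : Y → M) (N : NormalField I ι) (Φ : Y ≃ₜ Y) :
    g.HasCompleteFutureNullInfinity τ (ι ∘ Φ) (fun u ↦ N (Φ u)) ↔
      g.HasCompleteFutureNullInfinity τ ι N := by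
  constructor
  · rintro ⟨B₀, hB₀, hs⟩
    refine ⟨Φ '' B₀, hB₀.image Φ.continuous, fun s hs0 ↦ ?_⟩
    obtain ⟨B₁, hB₁, hray⟩ := hs s hs0
    refine ⟨Φ '' B₁, hB₁.image Φ.continuous, fun p hp γ dom hγ ↦ ?_⟩
    obtain ⟨q, rfl⟩ := Φ.surjective p
    have hq : q ∉ B₁ := fun h' ↦ hp ⟨q, h', rfl⟩
    rw [← Set.image_comp]
    exact hray q hq γ dom hγ
  · rintro ⟨B₀, hB₀, hs⟩
    refine ⟨Φ ⁻¹' B₀, Φ.isCompact_preimage.2 hB₀, fun s hs0 ↦ ?_⟩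
    obtain ⟨B₁, hB₁, hray⟩ := hs s hs0
    refine ⟨Φ ⁻¹' B₁, Φ.isCompact_preimage.2 hB₁, fun q hq γ dom hγ ↦ ?_⟩
    rw [Set.image_comp, Φ.image_preimage]
    exact hray (Φ q) hq γ dom hγ

end LorentzianMetric

variable {X : Type} [TopologicalSpace X] [ChartedSpace E3 X] [IsManifold (𝓡 3) ∞ X]

/-! ### Functoriality of the pull-back of data -/

namespace InitialDataSet

omit [IsManifold (𝓡 3) ∞ X] in
/-- The differentials of a composite of maps with injective differentials are injective (chain
rule). [folklore] -/
theorem injective_mfderiv_comp {Φ Ψ : X → X}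
    (hΦ : ContMDiff (𝓡 3) (𝓡 3) (∞ + 1) Φ) (hΦ' : ∀ u, Injective (mfderiv (𝓡 3) (𝓡 3) Φ u))
    (hΨ : ContMDiff (𝓡 3) (𝓡 3) (∞ + 1) Ψ) (hΨ' : ∀ u, Injective (mfderiv (𝓡 3) (𝓡 3) Ψ u))
    (u : X) : Injective (mfderiv (𝓡 3) (𝓡 3) (Φ ∘ Ψ) u) := by
  rw [mfderiv_comp u ((hΦ.of_le le_self_add).mdifferentiableAt (by simp))
    ((hΨ.of_le le_self_add).mdifferentiableAt (by simp))]
  exact (hΦ' _).comp (hΨ' u)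

/-- **Functoriality of the pull-back of initial data**: `Ψ^*(Φ^* D) = (Φ ∘ Ψ)^* D` (chain rule
for the differentials). O'Neill 1983, Ch. 3, p. 58. [cite: ONeill1983, Ch. 3, p. 58] -/
theorem comap_comap (D : InitialDataSet (𝓡 3) X) {Φ Ψ : X → X}
    (hΦ : ContMDiff (𝓡 3) (𝓡 3) (∞ + 1) Φ) (hΦ' : ∀ u, Injective (mfderiv (𝓡 3) (𝓡 3) Φ u))
    (hΨ : ContMDiff (𝓡 3) (𝓡 3) (∞ + 1) Ψ) (hΨ' : ∀ u, Injective (mfderiv (𝓡 3) (𝓡 3) Ψ u)) :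
    (D.comap Φ hΦ hΦ').comap Ψ hΨ hΨ' =
      D.comap (Φ ∘ Ψ) (hΦ.comp hΨ) (injective_mfderiv_comp hΦ hΦ' hΨ hΨ') := by
  refine InitialDataSet.ext' (fun u v w ↦ ?_) (fun u v w ↦ ?_)
  · simp only [InitialDataSet.comap_h_inner]
    rw [mfderiv_comp u ((hΦ.of_le le_self_add).mdifferentiableAt (by simp))
      ((hΨ.of_le le_self_add).mdifferentiableAt (by simp))]
    rfl
  · simp only [InitialDataSet.comap_k]
    rw [mfderiv_comp u ((hΦ.of_le le_self_add).mdifferentiableAt (by simp))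
      ((hΨ.of_le le_self_add).mdifferentiableAt (by simp))]
    rfl

/-- **Pulling back along `Φ` and then along a right inverse `Ψ` of `Φ` gives the datum back**:
`Ψ^*(Φ^* D) = (Φ ∘ Ψ)^* D = id^* D = D`. [cite: ONeill1983, Ch. 3, p. 58] -/
theorem comap_comp_eq_self (D : InitialDataSet (𝓡 3) X) {Φ Ψ : X → X}
    (hΦ : ContMDiff (𝓡 3) (𝓡 3) (∞ + 1) Φ) (hΦ' : ∀ u, Injective (mfderiv (𝓡 3) (𝓡 3) Φ u))
    (hΨ : ContMDiff (𝓡 3) (𝓡 3) (∞ + 1) Ψ) (hΨ' : ∀ u, Injective (mfderiv (𝓡 3) (𝓡 3) Ψ u))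
    (hid : Φ ∘ Ψ = id) : (D.comap Φ hΦ hΦ').comap Ψ hΨ hΨ' = D := by
  rw [comap_comap]
  exact D.comap_eq_self_of_eq_id _ _ hid

end InitialDataSet

/-! ### The re-indexed development -/

namespace VacuumCauchyDevelopment

variable [ConnectedSpace X] {D : InitialDataSet (𝓡 3) X}

/-- **The vacuum Cauchy development re-indexed along a diffeomorphism of the data manifold**:
`(M, g, τ, ι ∘ Φ, ν ∘ Φ)` as a vacuum Cauchy development of `Φ^* D` (same spacetime; data-embedding
fields from `DataEmbedding.comapAlong`; `range (ι ∘ Φ) = range ι` is the same Cauchy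
hypersurface). Choquet-Bruhat–Geroch 1969, p. 330; Ringström 2009, Def. 16.2.
[cite: ChoquetBruhatGeroch1969CMP, p. 330] -/
def precomp (𝒟 : VacuumCauchyDevelopment D) (Φ : X ≃ₜ X)
    (hΦ : ContMDiff (𝓡 3) (𝓡 3) (∞ + 1) Φ) (hΦ' : ∀ u, Injective (mfderiv (𝓡 3) (𝓡 3) Φ u)) :
    VacuumCauchyDevelopment (D.comap Φ hΦ hΦ') where
  toDataEmbedding := 𝒟.toDataEmbedding.comapAlong Φ hΦ hΦ' Φ.isOpenEmbedding
    fun u ↦ 𝒟.toDataEmbedding.mdifferentiableAt_embed_normal (Φ u)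
  isCauchyHypersurface := by
    show 𝒟.metric.IsCauchyHypersurface 𝒟.timeOrientation (range (𝒟.embed ∘ Φ))
    rw [Φ.surjective.range_comp]
    exact 𝒟.isCauchyHypersurface
  isRicciFlat := by
    intro inst
    haveI : 𝒟.metric.toPseudoRiemannianMetric.HasLeviCivita := inst
    exact 𝒟.isRicciFlat

variable (𝒟 : VacuumCauchyDevelopment D) (Φ : X ≃ₜ X)
  (hΦ : ContMDiff (𝓡 3) (𝓡 3) (∞ + 1) Φ) (hΦ' : ∀ u, Injective (mfderiv (𝓡 3) (𝓡 3) Φ u))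

/-- The re-indexed development has the same spacetime. [folklore] -/
@[simp] theorem precomp_toSpacetime : (𝒟.precomp Φ hΦ hΦ').toSpacetime = 𝒟.toSpacetime := rfl

/-- The re-indexed development has the embedding `ι ∘ Φ`. [folklore] -/
@[simp] theorem precomp_embed : (𝒟.precomp Φ hΦ hΦ').embed = 𝒟.embed ∘ Φ := rfl

/-- The re-indexed development has the normal field `ν ∘ Φ`. [folklore] -/
@[simp] theorem precomp_normal (u : X) : (𝒟.precomp Φ hΦ hΦ').normal u = 𝒟.normal (Φ u) := rfl

/-- The range of the re-indexed embedding is the same data hypersurface. [folklore] -/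
theorem range_precomp_embed : range (𝒟.precomp Φ hΦ hΦ').embed = range 𝒟.embed :=
  Φ.surjective.range_comp _

/-! ### Complete null infinity and adiabatic tracking are invariant -/

/-- **Complete future null infinity of the re-indexed development** (sojourn form, under the
standing Levi-Civita hypothesis) **iff of the original**. [cite: Christodoulou1999, pp. A26–A27] -/
theorem hasCompleteFutureNullInfinity_precomp_iff :
    (∀ [(𝒟.precomp Φ hΦ hΦ').metric.HasLeviCivita],
      (𝒟.precomp Φ hΦ hΦ').metric.HasCompleteFutureNullInfinity
        (𝒟.precomp Φ hΦ hΦ').timeOrientation (𝒟.precomp Φ hΦ hΦ').embed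
        (𝒟.precomp Φ hΦ hΦ').normal) ↔
    ∀ [𝒟.metric.HasLeviCivita],
      𝒟.metric.HasCompleteFutureNullInfinity 𝒟.timeOrientation 𝒟.embed 𝒟.normal := by
  constructor
  · intro h inst
    exact (𝒟.metric.hasCompleteFutureNullInfinity_comp_homeomorph 𝒟.timeOrientation 𝒟.embed
      𝒟.normal Φ).1 (@h inst)
  · intro h inst
    haveI : 𝒟.metric.HasLeviCivita := inst
    exact (𝒟.metric.hasCompleteFutureNullInfinity_comp_homeomorph 𝒟.timeOrientation 𝒟.embed
      𝒟.normal Φ).2 (@h inst)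

/-- **Adiabatic tracking of the re-indexed development iff of the original** (the predicate reads
the spacetime and `range ι` only). [cite: Klainerman2025, §2.3 (p. 559)] -/
theorem isAdiabaticallyTracked_precomp_iff (N : ℕ) (m₀ χ : ℝ) (ε : ENNReal) (L R₀ : ℝ) :
    (𝒟.precomp Φ hΦ hΦ').IsAdiabaticallyTracked N m₀ χ ε L R₀ ↔
      𝒟.IsAdiabaticallyTracked N m₀ χ ε L R₀ := by
  have hr' : range (𝒟.precomp Φ hΦ hΦ').embed = range 𝒟.embed := 𝒟.range_precomp_embed Φ hΦ hΦ'
  simp only [VacuumCauchyDevelopment.isAdiabaticallyTracked_iff, CauchyDevelopment.exteriorOf, hr']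
  rfl

/-! ### Maximality is invariant -/

/-- **The universal property of a maximal development, read for a development of EQUAL data**
(the equality enters by `subst`; no cast appears): if `𝒟` is a maximal vacuum Cauchy development
of `D₂` and `D₁ = D₂`, every vacuum Cauchy development `𝒟₁` of `D₁` embeds into `𝒟` compatibly
with the embeddings of `X`. Ringström 2009, Def. 16.5. [cite: Ringstrom2009, Def. 16.5] -/
theorem IsMaximal.exists_embedding_of_eq {D₁ D₂ : InitialDataSet (𝓡 3) X} (h : D₁ = D₂)
    {𝒟₂ : VacuumCauchyDevelopment D₂} (hmax : 𝒟₂.IsMaximal) (𝒟₁ : VacuumCauchyDevelopment D₁) :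
    ∃ ψ : 𝒟₁.carrier → 𝒟₂.carrier,
      ContMDiff (𝓡 4) (𝓡 4) ∞ ψ ∧ IsOpenEmbedding ψ ∧
        𝒟₁.metric.IsIsometricImmersion 𝒟₂.metric.toPseudoRiemannianMetric ψ ∧
        𝒟₁.timeOrientation.PreservesTimeOrientation ψ 𝒟₂.timeOrientation ∧
        ψ ∘ 𝒟₁.embed = 𝒟₂.embed := by
  subst h
  exact hmax 𝒟₁

/-- **Re-indexing preserves maximality**: if `𝒟` is maximal then so is `precomp 𝒟 Φ`, for `Φ` a
diffeomorphism (homeomorphism, smooth with injective differentials, inverse likewise). A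
development `𝒟'` of `Φ^* D` re-indexes along `Φ⁻¹` to one of `(Φ⁻¹)^*(Φ^* D) = D`
(`comap_comp_eq_self`), which embeds into `𝒟` by maximality; the same map embeds `𝒟'` into
`precomp 𝒟 Φ` (`ψ ∘ ι' = ψ ∘ ι' ∘ Φ⁻¹ ∘ Φ = ι ∘ Φ`). Choquet-Bruhat–Geroch 1969, p. 330;
Ringström 2009, Def. 16.5. [cite: Ringstrom2009, Def. 16.5] -/
theorem IsMaximal.precomp (hmax : 𝒟.IsMaximal)
    (hΨ : ContMDiff (𝓡 3) (𝓡 3) (∞ + 1) Φ.symm)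
    (hΨ' : ∀ u, Injective (mfderiv (𝓡 3) (𝓡 3) Φ.symm u)) :
    (𝒟.precomp Φ hΦ hΦ').IsMaximal := by
  intro 𝒟'
  have hD : (D.comap Φ hΦ hΦ').comap Φ.symm hΨ hΨ' = D :=
    D.comap_comp_eq_self hΦ hΦ' hΨ hΨ' (funext Φ.apply_symm_apply)
  obtain ⟨ψ, hψs, hψo, hψi, hψt, hψe⟩ :=
    IsMaximal.exists_embedding_of_eq hD hmax (𝒟'.precomp Φ.symm hΨ hΨ')
  refine ⟨ψ, hψs, hψo, hψi, hψt, ?_⟩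
  -- `ψ ∘ ι' = ι ∘ Φ`
  funext x
  have hx := congrFun hψe (Φ x)
  simp only [Function.comp_apply, precomp_embed, Homeomorph.symm_apply_apply] at hx
  simpa [Function.comp_apply] using hx

/-- **Conversely, if the re-indexed development is maximal then so is the original**: a development
`𝒟₁` of `D` re-indexes to `precomp 𝒟₁ Φ`, which embeds into `precomp 𝒟 Φ` by a map `ψ` with
`ψ ∘ ι₁ ∘ Φ = ι ∘ Φ`, whence `ψ ∘ ι₁ = ι` (`Φ` surjective). [cite: Ringstrom2009, Def. 16.5] -/
theorem IsMaximal.of_precomp (hmax : (𝒟.precomp Φ hΦ hΦ').IsMaximal) : 𝒟.IsMaximal := by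
  intro 𝒟₁
  obtain ⟨ψ, hψs, hψo, hψi, hψt, hψe⟩ := hmax (𝒟₁.precomp Φ hΦ hΦ')
  refine ⟨ψ, hψs, hψo, hψi, hψt, ?_⟩
  funext y
  obtain ⟨x, rfl⟩ := Φ.surjective y
  have hx := congrFun hψe x
  simpa [Function.comp_apply] using hx

/-- **`precomp 𝒟 Φ` is maximal iff `𝒟` is.** [cite: Ringstrom2009, Def. 16.5] -/
theorem isMaximal_precomp_iff (hΨ : ContMDiff (𝓡 3) (𝓡 3) (∞ + 1) Φ.symm)
    (hΨ' : ∀ u, Injective (mfderiv (𝓡 3) (𝓡 3) Φ.symm u)) :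
    (𝒟.precomp Φ hΦ hΦ').IsMaximal ↔ 𝒟.IsMaximal :=
  ⟨IsMaximal.of_precomp 𝒟 Φ hΦ hΦ', fun h ↦ h.precomp 𝒟 Φ hΦ hΦ' hΨ hΨ'⟩

/-! ### Transfer over all maximal developments of `Φ^* D` -/

/-- A property of vacuum Cauchy developments of arbitrary data holds over all maximal developments
of `D₁` iff over all maximal developments of an EQUAL datum `D₂` (`subst`). [folklore] -/
theorem forall_isMaximal_congr_of_eq {D₁ D₂ : InitialDataSet (𝓡 3) X} (h : D₁ = D₂)
    (P : ∀ {D' : InitialDataSet (𝓡 3) X}, VacuumCauchyDevelopment D' → Prop) :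
    (∀ 𝒟 : VacuumCauchyDevelopment D₁, 𝒟.IsMaximal → P 𝒟) ↔
      ∀ 𝒟 : VacuumCauchyDevelopment D₂, 𝒟.IsMaximal → P 𝒟 := by
  subst h
  exact Iff.rfl

/-- MGHD existence for `D₁` iff for an EQUAL datum `D₂` (`subst`). [folklore] -/
theorem exists_isMaximal_congr_of_eq {D₁ D₂ : InitialDataSet (𝓡 3) X} (h : D₁ = D₂) :
    (∃ 𝒟 : VacuumCauchyDevelopment D₁, 𝒟.IsMaximal) ↔
      ∃ 𝒟 : VacuumCauchyDevelopment D₂, 𝒟.IsMaximal := by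
  subst h
  exact Iff.rfl

/-- **MGHD existence is invariant under re-indexing the data**: `Φ^* D` has a maximal vacuum Cauchy
development iff `D` does. [cite: ChoquetBruhatGeroch1969CMP, p. 330] -/
theorem exists_isMaximal_comap_iff (hΨ : ContMDiff (𝓡 3) (𝓡 3) (∞ + 1) Φ.symm)
    (hΨ' : ∀ u, Injective (mfderiv (𝓡 3) (𝓡 3) Φ.symm u)) :
    (∃ 𝒟' : VacuumCauchyDevelopment (D.comap Φ hΦ hΦ'), 𝒟'.IsMaximal) ↔
      ∃ 𝒟 : VacuumCauchyDevelopment D, 𝒟.IsMaximal := by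
  constructor
  · rintro ⟨𝒟', h'⟩
    have hD : (D.comap Φ hΦ hΦ').comap Φ.symm hΨ hΨ' = D :=
      D.comap_comp_eq_self hΦ hΦ' hΨ hΨ' (funext Φ.apply_symm_apply)
    have hsymm : ContMDiff (𝓡 3) (𝓡 3) (∞ + 1) Φ.symm.symm := hΦ
    have hsymm' : ∀ u, Injective (mfderiv (𝓡 3) (𝓡 3) Φ.symm.symm u) := hΦ'
    exact (exists_isMaximal_congr_of_eq hD).1
      ⟨𝒟'.precomp Φ.symm hΨ hΨ', h'.precomp 𝒟' Φ.symm hΨ hΨ' hsymm hsymm'⟩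
  · rintro ⟨𝒟, h⟩
    exact ⟨𝒟.precomp Φ hΦ hΦ', h.precomp 𝒟 Φ hΦ hΦ' hΨ hΨ'⟩

/-- **Transfer principle.** A property `P` of vacuum Cauchy developments (of arbitrary data on `X`)
which is invariant under re-indexing along every diffeomorphism holds for all maximal developments
of `Φ^* D` iff it holds for all maximal developments of `D`. [cite: ChoquetBruhatGeroch1969CMP, p. 330] -/
theorem forall_isMaximal_comap_iff (hΨ : ContMDiff (𝓡 3) (𝓡 3) (∞ + 1) Φ.symm)
    (hΨ' : ∀ u, Injective (mfderiv (𝓡 3) (𝓡 3) Φ.symm u))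
    (P : ∀ {D' : InitialDataSet (𝓡 3) X}, VacuumCauchyDevelopment D' → Prop)
    (hP : ∀ {D' : InitialDataSet (𝓡 3) X} (𝒟 : VacuumCauchyDevelopment D') (Θ : X ≃ₜ X)
      (hΘ : ContMDiff (𝓡 3) (𝓡 3) (∞ + 1) Θ) (hΘ' : ∀ u, Injective (mfderiv (𝓡 3) (𝓡 3) Θ u)),
      P (𝒟.precomp Θ hΘ hΘ') ↔ P 𝒟) :
    (∀ 𝒟' : VacuumCauchyDevelopment (D.comap Φ hΦ hΦ'), 𝒟'.IsMaximal → P 𝒟') ↔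
      ∀ 𝒟 : VacuumCauchyDevelopment D, 𝒟.IsMaximal → P 𝒟 := by
  constructor
  · intro h 𝒟 h𝒟
    exact (hP 𝒟 Φ hΦ hΦ').1 (h _ (h𝒟.precomp 𝒟 Φ hΦ hΦ' hΨ hΨ'))
  · intro h 𝒟' h𝒟'
    have hD : (D.comap Φ hΦ hΦ').comap Φ.symm hΨ hΨ' = D :=
      D.comap_comp_eq_self hΦ hΦ' hΨ hΨ' (funext Φ.apply_symm_apply)
    have hsymm : ContMDiff (𝓡 3) (𝓡 3) (∞ + 1) Φ.symm.symm := hΦ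
    have hsymm' : ∀ u, Injective (mfderiv (𝓡 3) (𝓡 3) Φ.symm.symm u) := hΦ'
    have hmax'' : (𝒟'.precomp Φ.symm hΨ hΨ').IsMaximal :=
      h𝒟'.precomp 𝒟' Φ.symm hΨ hΨ' hsymm hsymm'
    have h'' := (forall_isMaximal_congr_of_eq hD P).2 h _ hmax''
    exact (hP 𝒟' Φ.symm hΨ hΨ').1 h''

/-! ### The development-level clauses of the final-state layer are invariant under `D ↦ Φ^* D` -/

/-- **Censoredness is invariant under re-indexing**: "`Φ^* D` has an MGHD and every MGHD of `Φ^* D`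
has complete `𝓘⁺` (sojourn form, standing Levi-Civita hypothesis)" iff the same for `D`.
[cite: Christodoulou1999, pp. A26–A27] -/
theorem censored_comap_iff (hΨ : ContMDiff (𝓡 3) (𝓡 3) (∞ + 1) Φ.symm)
    (hΨ' : ∀ u, Injective (mfderiv (𝓡 3) (𝓡 3) Φ.symm u)) :
    ((∃ 𝒟' : VacuumCauchyDevelopment (D.comap Φ hΦ hΦ'), 𝒟'.IsMaximal) ∧
      ∀ 𝒟' : VacuumCauchyDevelopment (D.comap Φ hΦ hΦ'), 𝒟'.IsMaximal →
        ∀ [𝒟'.metric.HasLeviCivita],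
          𝒟'.metric.HasCompleteFutureNullInfinity 𝒟'.timeOrientation 𝒟'.embed 𝒟'.normal) ↔
    ((∃ 𝒟 : VacuumCauchyDevelopment D, 𝒟.IsMaximal) ∧
      ∀ 𝒟 : VacuumCauchyDevelopment D, 𝒟.IsMaximal →
        ∀ [𝒟.metric.HasLeviCivita],
          𝒟.metric.HasCompleteFutureNullInfinity 𝒟.timeOrientation 𝒟.embed 𝒟.normal) := by
  refine and_congr (exists_isMaximal_comap_iff Φ hΦ hΦ' hΨ hΨ') ?_
  exact forall_isMaximal_comap_iff Φ hΦ hΦ' hΨ hΨ'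
    (fun {D'} 𝒟 ↦ ∀ [𝒟.metric.HasLeviCivita],
      𝒟.metric.HasCompleteFutureNullInfinity 𝒟.timeOrientation 𝒟.embed 𝒟.normal)
    fun 𝒟 Θ hΘ hΘ' ↦ hasCompleteFutureNullInfinity_precomp_iff 𝒟 Θ hΘ hΘ'

/-- **All-accuracy tracking (complexity free per accuracy) is invariant under re-indexing.**
[cite: Klainerman2025, §2.3 (p. 559)] -/
theorem quietTracking_comap_iff (hΨ : ContMDiff (𝓡 3) (𝓡 3) (∞ + 1) Φ.symm)
    (hΨ' : ∀ u, Injective (mfderiv (𝓡 3) (𝓡 3) Φ.symm u)) :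
    (∀ 𝒟' : VacuumCauchyDevelopment (D.comap Φ hΦ hΦ'), 𝒟'.IsMaximal →
      ∀ (L : ℝ) (ε : ENNReal) (R₀ : ℝ), 0 < L → 0 < ε →
        ∃ (N : ℕ) (m₀ χ : ℝ), 0 < m₀ ∧ 0 ≤ χ ∧ χ < 1 ∧ 𝒟'.IsAdiabaticallyTracked N m₀ χ ε L R₀) ↔
    ∀ 𝒟 : VacuumCauchyDevelopment D, 𝒟.IsMaximal →
      ∀ (L : ℝ) (ε : ENNReal) (R₀ : ℝ), 0 < L → 0 < ε →
        ∃ (N : ℕ) (m₀ χ : ℝ), 0 < m₀ ∧ 0 ≤ χ ∧ χ < 1 ∧ 𝒟.IsAdiabaticallyTracked N m₀ χ ε L R₀ := by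
  refine forall_isMaximal_comap_iff Φ hΦ hΦ' hΨ hΨ'
    (fun {D'} 𝒟 ↦ ∀ (L : ℝ) (ε : ENNReal) (R₀ : ℝ), 0 < L → 0 < ε →
      ∃ (N : ℕ) (m₀ χ : ℝ), 0 < m₀ ∧ 0 ≤ χ ∧ χ < 1 ∧ 𝒟.IsAdiabaticallyTracked N m₀ χ ε L R₀)
    fun 𝒟 Θ hΘ hΘ' ↦ ?_
  simp only [isAdiabaticallyTracked_precomp_iff]

/-- **All-accuracy tracking with ONE complexity is invariant under re-indexing.**
[cite: Klainerman2025, §2.3 (p. 559)] -/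
theorem marginTracking_comap_iff (hΨ : ContMDiff (𝓡 3) (𝓡 3) (∞ + 1) Φ.symm)
    (hΨ' : ∀ u, Injective (mfderiv (𝓡 3) (𝓡 3) Φ.symm u)) :
    (∀ 𝒟' : VacuumCauchyDevelopment (D.comap Φ hΦ hΦ'), 𝒟'.IsMaximal →
      ∃ (N : ℕ) (m₀ χ : ℝ), 0 < m₀ ∧ 0 ≤ χ ∧ χ < 1 ∧
        ∀ (L : ℝ) (ε : ENNReal) (R₀ : ℝ), 0 < L → 0 < ε → 𝒟'.IsAdiabaticallyTracked N m₀ χ ε L R₀) ↔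
    ∀ 𝒟 : VacuumCauchyDevelopment D, 𝒟.IsMaximal →
      ∃ (N : ℕ) (m₀ χ : ℝ), 0 < m₀ ∧ 0 ≤ χ ∧ χ < 1 ∧
        ∀ (L : ℝ) (ε : ENNReal) (R₀ : ℝ), 0 < L → 0 < ε → 𝒟.IsAdiabaticallyTracked N m₀ χ ε L R₀ := by
  refine forall_isMaximal_comap_iff Φ hΦ hΦ' hΨ hΨ'
    (fun {D'} 𝒟 ↦ ∃ (N : ℕ) (m₀ χ : ℝ), 0 < m₀ ∧ 0 ≤ χ ∧ χ < 1 ∧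
      ∀ (L : ℝ) (ε : ENNReal) (R₀ : ℝ), 0 < L → 0 < ε → 𝒟.IsAdiabaticallyTracked N m₀ χ ε L R₀)
    fun 𝒟 Θ hΘ hΘ' ↦ ?_
  simp only [isAdiabaticallyTracked_precomp_iff]

end VacuumCauchyDevelopment

end Literature.Geometry.Lorentzian

end
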